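import Summits.QuantumFields.YangMills.Theorems.AllWindowsColdBoxBoxHighWindowsSU22LineDefs
import Literature.Probability.LatticeModels.DirichletGreenFunction
import Literature.Probability.LatticeModels.LatticeDirichletEnergy
import Literature.MathematicalPhysics.QuantumFieldTheory.Balaban1983to89.Beta.PoissonInterior

/-!
# T-S5 STEP 2 kernel bricks: the task's objects (`siteDist`, `cubeSites`, `CubeShellSums`, `CubeTwoCentreSums`, `GhostKernelDecay`) VERBATIM,
# and T-S5.9 `ghostKernelDecay : GhostKernelDecay` PROVED

Planner ym-idea-2 g18's typed task `Cruxes/BoxHighWindowsSU22/TaskS5Step2Kernels.lean` (commit 51ce4044ffc9; `STUB-PLAN-S5-STEP2.md`), for the XL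
stub S5 `stub_landauSecondOrder` (LINE-19 ⟨stmt-QuantumFields-24004⟩/⟨24335⟩).  A `Cruxes/` file is not importable from `Theorems/`, so this file
carries the task's two defs and three Props BYTE-FOR-BYTE (one FQN each — T-S5.8a/8b provers: `import` this file, do not redeclare), and proves

* **T-S5.9 `ghostKernelDecay : GhostKernelDecay`** — Coulomb decay of the ghost propagator `G_Δ = (dirichletMatrix (interiorSites H))⁻¹`:
  `0 ≤ G_Δ(x,y) ≤ C/(1 + d(x,y))²`, uniformly in `H`.  Exactly the route the task names: `G_Δ(x,y) = dirichletGreen _ x y`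
  (✓`dirichletGreen_of_mem`) `≥ 0` (✓`dirichletGreen_nonneg`) and `≤ latticeGreen (x − y)/2 = G₀(x − y)` (✓`dirichletGreen_le_half_latticeGreen`,
  `d = 4 ≥ 3`) `≤ C₀ / nrm(x − y)²` (✓`Beta.PoissonInterior.G₀_bound`), with `1 + d(x,y) ≤ 2·nrm(x − y)` (`siteDist x y ≤ supNorm (x − y) ≤ nrm`,
  `1 ≤ nrm`); `C = 4·C₀`.

Tree + Mathlib; the only definitions are the task's (verbatim); standard axioms.  HONEST LABEL: an S-sized support lemma of STEP 2 of the XL stub S5;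
T-S5.8a/8b (typed here) are NOT proved in this file; S5, U5, ⟨24004⟩ ⟨24335⟩ ⟨24336⟩ remain OPEN; route AllWindowsColdBox is DRAFT; no summit is
proved; the Yang–Mills mass gap is NOT proved by this file.  Seat ym-line-sfw-p2-w5 g21 (cell ym-idea-1).
-/

set_option autoImplicit false

noncomputable section

open Real Finset
open Literature.Probability.LatticeModels (Site dirichletMatrix dirichletGreen dirichletGreen_of_mem dirichletGreen_nonneg
  dirichletGreen_le_half_latticeGreen)
open Literature.MathematicalPhysics.QuantumFieldTheory.Balaban1983to89.Beta.PoissonInterior (G₀ nrm supNorm G₀_bound one_le_nrm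
  supNorm_le_nrm natAbs_le_supNorm)

namespace Summit.QuantumFields.YangMills.Theorems.AllWindowsColdBoxBoxHighLine

/-! ## The task's objects (verbatim from `TaskS5Step2Kernels.lean`) -/

/-- Sup-distance of two sites of `ℤ⁴` as a real number — the convention of ✓S3b `LandauKernelDecay`
(`⨆ k, |x k − y k|`). -/
def siteDist (x y : Site 4) : ℝ := ⨆ k : Fin 4, |((x k - y k : ℤ) : ℝ)|

/-- The sites of the cube `[0,N]⁴`. -/
def cubeSites (N : ℕ) : Finset (Site 4) := Fintype.piFinset fun _ => Finset.Icc (0 : ℤ) N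

/-- **T-S5.8a — single shell sums in the cube**, uniformly in the centre `x ∈ ℤ⁴`:
`Σ_{p ∈ [0,N]⁴} (1+d(p,x))⁻² ≤ C N²`, `Σ (1+d(p,x))⁻⁴ ≤ C (1 + log N)`, `Σ (1+d(p,x))⁻⁵ ≤ C` (`N ≥ 1`). -/
def CubeShellSums : Prop :=
  ∃ C : ℝ, ∀ N : ℕ, 1 ≤ N → ∀ x : Site 4,
    (∑ p ∈ cubeSites N, 1 / (1 + siteDist p x) ^ 2 ≤ C * (N : ℝ) ^ 2) ∧
    (∑ p ∈ cubeSites N, 1 / (1 + siteDist p x) ^ 4 ≤ C * (1 + Real.log N)) ∧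
    (∑ p ∈ cubeSites N, 1 / (1 + siteDist p x) ^ 5 ≤ C)

/-- **T-S5.8b — two-centre convolution sums in the cube**, uniformly in the centres `x y ∈ ℤ⁴` (`N ≥ 1`):
`Σ_p (1+d(p,x))⁻²(1+d(p,y))⁻² ≤ C(1+log N)`, `Σ_p (1+d(p,x))⁻²(1+d(p,y))⁻⁴ ≤ C(1+log N)/(1+d(x,y))²`,
`Σ_p (1+d(p,x))⁻⁴(1+d(p,y))⁻⁴ ≤ C(1+log N)/(1+d(x,y))⁴`. -/
def CubeTwoCentreSums : Prop :=
  ∃ C : ℝ, ∀ N : ℕ, 1 ≤ N → ∀ x y : Site 4,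
    (∑ p ∈ cubeSites N, 1 / ((1 + siteDist p x) ^ 2 * (1 + siteDist p y) ^ 2) ≤ C * (1 + Real.log N)) ∧
    (∑ p ∈ cubeSites N, 1 / ((1 + siteDist p x) ^ 2 * (1 + siteDist p y) ^ 4) ≤ C * (1 + Real.log N) / (1 + siteDist x y) ^ 2) ∧
    (∑ p ∈ cubeSites N, 1 / ((1 + siteDist p x) ^ 4 * (1 + siteDist p y) ^ 4) ≤ C * (1 + Real.log N) / (1 + siteDist x y) ^ 4)

/-- **T-S5.9 — Coulomb decay of the ghost propagator** `G_Δ = (dirichletMatrix (interiorSites H))⁻¹` (the Dirichlet Green function of the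
interior sites, `= −(fpOperator H 1)⁻¹` modulo `⊗ pauliPerm⁻¹` by ✓`fpOperator_one`): `0 ≤ G_Δ(x,y) ≤ C/(1 + d(x,y))²`, uniformly in `H`. -/
def GhostKernelDecay : Prop :=
  ∃ C : ℝ, ∀ H : ℕ, 1 ≤ H → ∀ x y : ↥(interiorSites H),
    0 ≤ (dirichletMatrix (interiorSites H))⁻¹ x y ∧
      (dirichletMatrix (interiorSites H))⁻¹ x y ≤ C / (1 + siteDist (x : Site 4) (y : Site 4)) ^ 2

/-! ## T-S5.9 -/

namespace GhostKernel

/-- The sup-distance is dominated by the (integer) sup-norm of the difference. -/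
theorem siteDist_le_supNorm (x y : Site 4) : siteDist x y ≤ (supNorm (x - y) : ℝ) := by
  unfold siteDist
  refine ciSup_le fun k => ?_
  have h1 : |((x k - y k : ℤ) : ℝ)| = (((x - y) k).natAbs : ℝ) := by
    rw [Nat.cast_natAbs, Int.cast_abs, Pi.sub_apply]
  rw [h1]
  exact_mod_cast natAbs_le_supNorm (x - y) k

/-- `0 ≤ siteDist`. -/
theorem siteDist_nonneg (x y : Site 4) : 0 ≤ siteDist x y := by
  unfold siteDist
  exact le_ciSup_of_le (Set.finite_range _).bddAbove 0 (abs_nonneg _)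

/-- `1 + d(x,y) ≤ 2·nrm(x − y)`. -/
theorem one_add_siteDist_le (x y : Site 4) : 1 + siteDist x y ≤ 2 * nrm (x - y) := by
  have h1 := one_le_nrm (x - y)
  have h2 := (siteDist_le_supNorm x y).trans (supNorm_le_nrm (x - y))
  linarith

end GhostKernel

open GhostKernel

/-- **T-S5.9: Coulomb decay of the ghost propagator** (`C = 4·C₀`, `C₀` the constant of ✓`G₀_bound` in `d = 4`). -/
theorem ghostKernelDecay : GhostKernelDecay := by
  obtain ⟨C₀, hC₀, hG₀⟩ := G₀_bound (d := 4) (by norm_num)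
  refine ⟨4 * C₀, fun H _ x y => ?_⟩
  have hxy : (dirichletMatrix (interiorSites H))⁻¹ x y = dirichletGreen (interiorSites H) (x : Site 4) (y : Site 4) := by
    rw [dirichletGreen_of_mem x.2 y.2]
  rw [hxy]
  refine ⟨dirichletGreen_nonneg (by norm_num) _ _ _, ?_⟩
  have hup : dirichletGreen (interiorSites H) (x : Site 4) (y : Site 4) ≤ G₀ ((x : Site 4) - (y : Site 4)) :=
    dirichletGreen_le_half_latticeGreen 4 (by norm_num) (interiorSites H) (x : Site 4) (y : Site 4)
  have hn0 : 0 < nrm ((x : Site 4) - (y : Site 4)) := lt_of_lt_of_le one_pos (one_le_nrm _)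
  have hs0 : 0 ≤ siteDist (x : Site 4) (y : Site 4) := siteDist_nonneg _ _
  have hle := one_add_siteDist_le (x : Site 4) (y : Site 4)
  have hb : G₀ ((x : Site 4) - (y : Site 4)) ≤ C₀ / nrm ((x : Site 4) - (y : Site 4)) ^ 2 := by
    have h := hG₀ ((x : Site 4) - (y : Site 4))
    norm_num at h
    exact (le_abs_self _).trans h
  calc dirichletGreen (interiorSites H) (x : Site 4) (y : Site 4) ≤ G₀ ((x : Site 4) - (y : Site 4)) := hup
    _ ≤ C₀ / nrm ((x : Site 4) - (y : Site 4)) ^ 2 := hb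
    _ ≤ 4 * C₀ / (1 + siteDist (x : Site 4) (y : Site 4)) ^ 2 := by
        rw [div_le_div_iff₀ (by positivity) (by positivity)]
        have h3 : 0 ≤ C₀ * (2 * nrm ((x : Site 4) - (y : Site 4)) - (1 + siteDist (x : Site 4) (y : Site 4))) *
            (2 * nrm ((x : Site 4) - (y : Site 4)) + (1 + siteDist (x : Site 4) (y : Site 4))) :=
          mul_nonneg (mul_nonneg hC₀ (by linarith)) (by linarith)
        nlinarith [h3]

end Summit.QuantumFields.YangMills.Theorems.AllWindowsColdBoxBoxHighLine

end
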